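import Summits.QuantumFields.BalabanUV.T4Continuum.Support.CTCovariantLaplacianDecay
import Summits.QuantumFields.BalabanUV.T4Continuum.Support.ScalarCovariantCTDefects
import Summits.QuantumFields.BalabanUV.T4Continuum.Support.CTWeightedEnergy

/-!
# T⁴ programme, spine node NE2 (U1a), sub-row Δ3 «NE2-WALK» (T4-DAG `T4-U1a.S-NE2-D3-WALK°`) — THE COVARIANT SCALAR GREEN FUNCTION
# `G′_U = (D_RᴴD_R + a′Q′ᴴQ′)⁻¹` AND ITS GRADIENT SANDWICHES UNDER COMBES–THOMAS CONJUGATION, `n`-UNIFORMLY, FROM THE SUBSTRATE's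
# COERCIVITY AND ROW DEFECT (the covariant twin of substrate VEC-3b `CTScalarGreen`; first file of «Δ3-CT-HBD-B4» = the gauge slot)

NE2 formalisation swarm `b2b-balaban-t4-ne2-formalise-*`, leaf prover 06 (gen 3), supplier item «Δ3-CT-HBD-B4» file E1 (follower of «Δ3-CT»
p220700∕p220892, «Δ3-CT-HBD» p221704∕p221931, «Δ3-CT-HBD-B3»; owner ruling R21 (c)).  The gauge slot `P₄ = −(D_R P_U D_Rᴴ − (∂⊗1)P_1(∂⊗1)ᴴ)` of
Bałaban's typed operator (row B4) is built from the covariant scalar Green function `G′_U = S_U⁻¹`, `S_U = D_RᴴD_R + a′·(B·T)ᴴ(B·T)`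
(`ScalarCovariantLaplacian.scalarOp`; `GaugeTermScalarData.Sop_eq_scalarOp`).  THIS FILE supplies its conjugation bounds at one level `n`, for a
site weight `ρ₀` that is `1/n`-Lipschitz along fine bonds and oscillates by `≤ 1` on blocks (e.g. `CTKingTowerWeights.rhoSite k y`), with the
site weight `siteW ρ₀` on `Tor (fine n M) × o` and the bond weight `ρ₀ ∘ fst ∘ fst` on `(Tor (fine n M) × Fin d) × o`:

 * §1 **`opNorm_conjMat_covGrad_sub_le`**: `‖c(D_R) − D_R‖ ≤ cR d α κ := d(1 + α)|κ|e^{|κ|}` (`D_R = Σ_μ n(T_μ(S_μ⊗1) − 1)(ι_μ⊗1)`; the site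
   factors and the embeddings `ι_μ ⊗ 1` commute with the conjugation — `conjMat_of_sameWeight` —, the shift moves by `e^{|κ|/n} − 1`
   — «Δ3-CT-HBD» C1's `opNorm_conjMat_shiftM_sub_le` —, `n(e^{|κ|/n} − 1) ≤ |κ|e^{|κ|}`), and the adjoint `‖c(D_Rᴴ) − D_Rᴴ‖ ≤ cR`;
 * §2 **`conjDefect_scalarOp`**, **`wCoercive_scalarOp`**: `WCoercive S_U κ (siteW ρ₀) (γ_U − Jcov)` from the SUBSTRATE's
   `ScalarCovariantCoercive.coercive_scalarOp` (`γ_U = gammaU d a′ α τ`) and `ScalarCovariantCTDefects.ctRowDefect_scalarOp_le_uniform`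
   (`Jcov (card o) d a′ α τ κ`, free of `n`) via `CTWeightedCoercivity.conjDefect_of_rowDefect` ∕ `wCoercive_of_coercive`;
 * §3 THE BOUNDS (instances of the substrate's generic weighted-energy kit `CTWeightedEnergy` at `A = S_U = D_RᴴD_R + Y`, `Y = a′(BT)ᴴ(BT) ⪰ 0`,
   `X = D_R`, `c = cR`), with `γw = γ_U − Jcov > 0`: **`opNorm_conjMat_scalarOp_inv_le`** `‖c(G′_U)‖ ≤ γw⁻¹`; **`opNorm_conjMat_covGrad_inv_le`**
   `‖c(D_RG′_U)‖ ≤ √(1/γw + J/γw²) + cR/γw`; **`opNorm_conjMat_inv_covGradH_le`** `‖c(G′_UD_Rᴴ)‖ ≤ K₂`; **`opNorm_conjMat_sand_inv_le`**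
   `‖c(D_RG′_UD_Rᴴ)‖ ≤ K₁ + cR·K₂` (`K₁ = K1 γw Jcov cR`, `K₂ = K2 γw Jcov cR`).

HONEST FRAMING (T4-DAG p. 1).  Bookkeeping over the substrate's landed modules ([folklore] lattice linear algebra); statements and the constant
`cR` OURS; MODEL level (transporters `R`, site transports `T` are DATA; no B0); nothing printed is asserted; nothing of any NE row is an
estimate here; the gauge slot's unit-lattice factor `N = (Q′G′G′Q′ᴴ)⁻¹` and the assembly of `hP₄` are files E2∕E3 (NOT here); Δ3 NOT closed;
NE2 (U1a) NOT PROVED; spine PROVED 0/9 unchanged; NOT infinite volume, NOT a mass gap, NOT the Clay problem, NOT summit progress.  HONEST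
DEPENDENCY: continuum YM on T⁴ ⇐ BetaPertH ∧ nine spine estimates (0/9 proved); BetaPertH ⇐ (D1) ∧ (D4) ∧ CAP+tail; G-an2-4 gates asym, D1
and NE2/3/4.  ABSOLUTE RULE kept; no `sorry`.
-/

noncomputable section

open scoped BigOperators ComplexConjugate Matrix Matrix.Norms.L2Operator Kronecker ComplexOrder

namespace Summit.QuantumFields.BalabanUV.T4Continuum.CTCovariantScalarGreen

open Literature.MathematicalPhysics.QuantumFieldTheory.Balaban1983to89.B5Prop11Plancherel (Tor fine shiftM unitVec)
open Literature.MathematicalPhysics.QuantumFieldTheory.Balaban1983to89.B5Blocks16 (blockOf)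
open Summit.QuantumFields.BalabanUV.T4Continuum
open Summit.QuantumFields.BalabanUV.T4Continuum.CoerciveInverseTower (Coercive)
open Summit.QuantumFields.BalabanUV.T4Continuum.BlockMultiplication (siteMul siteMul_apply opNorm_siteMul_le)
open Summit.QuantumFields.BalabanUV.T4Continuum.KroneckerLift (opNorm_kron_le_of_le sub_kronecker)
open Summit.QuantumFields.BalabanUV.T4Continuum.BlockPairingGeometry (opNorm_shiftM_le)
open Summit.QuantumFields.BalabanUV.T4Continuum.GaugeTermDecomposition (injM liftR covGrad sand opNorm_injM_le)
open Summit.QuantumFields.BalabanUV.T4Continuum.ScalarCovariantLaplacian (scalarOp connS covLapS Bs covGrad_conjTranspose_mul_covGrad)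
open Summit.QuantumFields.BalabanUV.T4Continuum.ScalarCovariantCoercive (gammaU siteW Jcov Jcov_nonneg coercive_scalarOp scalarOp_isHermitian)
open Summit.QuantumFields.BalabanUV.T4Continuum.ScalarCovariantCTDefects (ctRowDefect_scalarOp_le_uniform)
open Summit.QuantumFields.BalabanUV.T4Continuum.CTWeightedCoercivity
open Summit.QuantumFields.BalabanUV.T4Continuum.CTConjugationPieces (opNorm_conjMat_le_add conjMat_of_sameWeight nat_mul_exp_div_sub_one_le
  opNorm_conjMat_conjTranspose_sub_eq)
open Summit.QuantumFields.BalabanUV.T4Continuum.CTWeightedEnergy (K1 K2 K1_nonneg K2_nonneg opNorm_conjMat_inv_le' opNorm_conjMat_X_inv_le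
  opNorm_conjMat_inv_XH_le opNorm_conjMat_X_inv_XH_le opNorm_X_conjMat_inv_XH_le)
open Summit.QuantumFields.BalabanUV.T4Continuum.CTConjugatedHbd (opNorm_conjMat_shiftM_sub_le conjMat_finset_sum)
open Summit.QuantumFields.BalabanUV.T4Continuum.CTCovariantLaplacianDecay (conjMat_kron)

variable {d : ℕ} (n : ℕ) [NeZero n] (M : Fin d → ℕ) [hM : ∀ μ, NeZero (M μ)]
variable {o : Type*} [Fintype o] [DecidableEq o]

/-- the bond-colour weight: the site weight of the base site, read on `(Tor (fine n M) × Fin d) × o`. [folklore] -/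
abbrev bondCW (ρ₀ : Tor (fine n M) → ℝ) : (Tor (fine n M) × Fin d) × o → ℝ := fun p => ρ₀ p.1.1

/-! ## §1 The covariant gradient under conjugation -/

section Gradient

variable {ρ₀ : Tor (fine n M) → ℝ} {κ : ℝ}

/-- the conjugation error of the covariant gradient: `cR = d·(1 + α)·|κ|·e^{|κ|}`. [folklore] -/
def cR (d : ℕ) (α κ : ℝ) : ℝ := d * (1 + α) * (|κ| * Real.exp |κ|)

omit [NeZero n] hM in
/-- `cR ≥ 0`. [folklore] -/
theorem cR_nonneg (d : ℕ) {α : ℝ} (hα : 0 ≤ α) (κ : ℝ) : 0 ≤ cR d α κ := by unfold cR; positivity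

omit [NeZero n] hM [Fintype o] in
/-- the embeddings `ι_μ ⊗ 1` commute with the conjugation (the bond `(x, μ)` and the site `x` carry the same weight). [folklore] -/
theorem conjMat_injM_kron (μ : Fin d) :
    conjMat κ (bondCW n M (o := o) ρ₀) (siteW n M ρ₀) (injM (fine n M) μ ⊗ₖ (1 : Matrix o o ℂ)) = injM (fine n M) μ ⊗ₖ (1 : Matrix o o ℂ) := by
  refine conjMat_of_sameWeight κ _ _ _ fun p q h => ?_
  rw [Matrix.kroneckerMap_apply] at h
  have h1 : injM (fine n M) μ p.1 q.1 ≠ 0 := left_ne_zero_of_mul h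
  simp only [injM, ne_eq, ite_eq_right_iff, one_ne_zero, imp_false, not_not] at h1
  show ρ₀ p.1.1 = ρ₀ q.1
  rw [h1]

omit [NeZero n] hM [Fintype o] [DecidableEq o] in
/-- the site factors commute with the conjugation. [folklore] -/
theorem conjMat_siteMul_bond (w : Tor (fine n M) × Fin d → Matrix o o ℂ) :
    conjMat κ (bondCW n M (o := o) ρ₀) (bondCW n M (o := o) ρ₀) (siteMul w) = siteMul w := by
  refine conjMat_of_sameWeight κ _ _ _ fun p q h => ?_
  rw [siteMul_apply] at h
  by_cases hpq : p.1 = q.1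
  · show ρ₀ p.1.1 = ρ₀ q.1.1; rw [hpq]
  · exact absurd (if_neg hpq) (fun h0 => h (h0 ▸ rfl))

/-- **`‖c(D_R) − D_R‖ ≤ cR`**, `n`-UNIFORMLY, for a `1/n`-Lipschitz site weight and transporters of size `‖n(R_μ(x) − 1)‖ ≤ α`. [folklore] -/
theorem opNorm_conjMat_covGrad_sub_le {R : Fin d → (Tor (fine n M) → Matrix o o ℂ)} {α : ℝ} (hα : 0 ≤ α)
    (hR : ∀ μ x, ‖connS (fine n M) ((n : ℕ) : ℂ) R μ x‖ ≤ α) (hlip : ∀ x ν, |ρ₀ (x + unitVec (fine n M) ν) - ρ₀ x| ≤ 1 / n) (κ : ℝ) :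
    ‖conjMat κ (bondCW n M (o := o) ρ₀) (siteW n M ρ₀) (covGrad (fine n M) ((n : ℕ) : ℂ) R) - covGrad (fine n M) ((n : ℕ) : ℂ) R‖
      ≤ cR d α κ := by
  have hn1 : 1 ≤ n := Nat.one_le_iff_ne_zero.mpr (NeZero.ne n)
  have hn : (0 : ℝ) < n := by exact_mod_cast hn1
  have hn1' : (1 : ℝ) ≤ n := by exact_mod_cast hn1
  have hn0 : (n : ℝ) ≠ 0 := hn.ne'
  have hnα : (n : ℝ) * (1 + α / n) = n + α := by rw [mul_add, mul_one, ← mul_div_assoc, mul_div_cancel_left₀ α hn0]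
  have hE0 : 0 ≤ Real.exp (|κ| * (1 / n)) - 1 := sub_nonneg.mpr (Real.one_le_exp (by positivity))
  -- size of the transporters: `‖R_μ(x)‖ ≤ 1 + α/n`
  have hRle : ∀ μ (i : Tor (fine n M) × Fin d), ‖liftR (fine n M) R μ i‖ ≤ 1 + α / n := by
    intro μ i
    have h1 : ‖R μ i.1 - 1‖ ≤ α / n := by
      have h := hR μ i.1
      rw [connS, norm_smul, Complex.norm_natCast] at h
      rw [le_div_iff₀ hn, mul_comm]; exact h
    have hone : ‖(1 : Matrix o o ℂ)‖ ≤ 1 := by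
      rw [Matrix.cstar_norm_def, map_one]; exact ContinuousLinearMap.norm_id_le
    calc ‖liftR (fine n M) R μ i‖ = ‖(1 : Matrix o o ℂ) + (R μ i.1 - 1)‖ := by rw [liftR, add_sub_cancel]
      _ ≤ ‖(1 : Matrix o o ℂ)‖ + ‖R μ i.1 - 1‖ := norm_add_le _ _
      _ ≤ 1 + α / n := add_le_add hone h1
  -- the shift under conjugation (C1), with the bond weight `ρ₀ ∘ fst`
  have hℓ : ∀ (x : Tor (fine n M)) (μ ν : Fin d),
      |(fun b : Tor (fine n M) × Fin d => ρ₀ b.1) (x + unitVec (fine n M) ν, μ) - (fun b : Tor (fine n M) × Fin d => ρ₀ b.1) (x, μ)| ≤ 1 / n :=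
    fun x μ ν => hlip x ν
  have hS : ∀ μ, ‖conjMat κ (bondCW n M (o := o) ρ₀) (bondCW n M (o := o) ρ₀) (shiftM (fine n M) μ ⊗ₖ (1 : Matrix o o ℂ))
      - shiftM (fine n M) μ ⊗ₖ (1 : Matrix o o ℂ)‖ ≤ Real.exp (|κ| * (1 / n)) - 1 := by
    intro μ
    have e : conjMat κ (bondCW n M (o := o) ρ₀) (bondCW n M (o := o) ρ₀) (shiftM (fine n M) μ ⊗ₖ (1 : Matrix o o ℂ))
        = conjMat κ (fun b : Tor (fine n M) × Fin d => ρ₀ b.1) (fun b : Tor (fine n M) × Fin d => ρ₀ b.1) (shiftM (fine n M) μ)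
          ⊗ₖ (1 : Matrix o o ℂ) :=
      conjMat_kron κ (fun b : Tor (fine n M) × Fin d => ρ₀ b.1) (fun b : Tor (fine n M) × Fin d => ρ₀ b.1) (shiftM (fine n M) μ)
        (1 : Matrix o o ℂ)
    rw [e, ← sub_kronecker]
    exact opNorm_kron_le_of_le o (opNorm_conjMat_shiftM_sub_le n M κ hℓ μ)
  -- term by term
  have hterm : ∀ μ ∈ (Finset.univ : Finset (Fin d)),
      ‖conjMat κ (bondCW n M (o := o) ρ₀) (siteW n M ρ₀)
          ((((n : ℕ) : ℂ) • (siteMul (liftR (fine n M) R μ) * shiftM (fine n M) μ ⊗ₖ (1 : Matrix o o ℂ) - 1)) * injM (fine n M) μ ⊗ₖ (1 : Matrix o o ℂ))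
        - (((n : ℕ) : ℂ) • (siteMul (liftR (fine n M) R μ) * shiftM (fine n M) μ ⊗ₖ (1 : Matrix o o ℂ) - 1)) * injM (fine n M) μ ⊗ₖ (1 : Matrix o o ℂ)‖
        ≤ (1 + α) * (|κ| * Real.exp |κ|) := by
    intro μ _
    rw [conjMat_mul κ _ (bondCW n M (o := o) ρ₀) _, conjMat_injM_kron, conjMat_smul, conjMat_sub, conjMat_one,
      conjMat_mul κ _ (bondCW n M (o := o) ρ₀) _, conjMat_siteMul_bond, ← Matrix.sub_mul,
      show ((n : ℕ) : ℂ) • (siteMul (liftR (fine n M) R μ)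
            * conjMat κ (bondCW n M (o := o) ρ₀) (bondCW n M (o := o) ρ₀) (shiftM (fine n M) μ ⊗ₖ (1 : Matrix o o ℂ)) - 1)
          - ((n : ℕ) : ℂ) • (siteMul (liftR (fine n M) R μ) * shiftM (fine n M) μ ⊗ₖ (1 : Matrix o o ℂ) - 1)
          = ((n : ℕ) : ℂ) • (siteMul (liftR (fine n M) R μ)
            * (conjMat κ (bondCW n M (o := o) ρ₀) (bondCW n M (o := o) ρ₀) (shiftM (fine n M) μ ⊗ₖ (1 : Matrix o o ℂ))
              - shiftM (fine n M) μ ⊗ₖ (1 : Matrix o o ℂ))) by rw [Matrix.mul_sub, ← smul_sub, sub_sub_sub_cancel_right]]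
    calc _ ≤ ‖((n : ℕ) : ℂ) • (siteMul (liftR (fine n M) R μ)
            * (conjMat κ (bondCW n M (o := o) ρ₀) (bondCW n M (o := o) ρ₀) (shiftM (fine n M) μ ⊗ₖ (1 : Matrix o o ℂ))
              - shiftM (fine n M) μ ⊗ₖ (1 : Matrix o o ℂ)))‖ * ‖injM (fine n M) μ ⊗ₖ (1 : Matrix o o ℂ)‖ := Matrix.l2_opNorm_mul _ _
      _ ≤ ((n : ℝ) * ((1 + α / n) * (Real.exp (|κ| * (1 / n)) - 1))) * 1 := by
          refine mul_le_mul ?_ (opNorm_kron_le_of_le o (opNorm_injM_le _ μ)) (norm_nonneg _)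
            (mul_nonneg hn.le (mul_nonneg (by positivity) hE0))
          rw [norm_smul, Complex.norm_natCast]
          exact mul_le_mul_of_nonneg_left ((Matrix.l2_opNorm_mul _ _).trans
            (mul_le_mul (opNorm_siteMul_le _ (by positivity) (hRle μ)) (hS μ) (norm_nonneg _) (by positivity))) hn.le
      _ = (n + α) * (Real.exp (|κ| * (1 / n)) - 1) := by rw [mul_one, ← mul_assoc, hnα]
      _ ≤ ((1 + α) * n) * (Real.exp (|κ| * (1 / n)) - 1) := mul_le_mul_of_nonneg_right (by nlinarith) hE0
      _ = (1 + α) * ((n : ℝ) * (Real.exp (|κ| / n) - 1)) := by rw [mul_one_div]; ring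
      _ ≤ (1 + α) * (|κ| * Real.exp |κ|) :=
          mul_le_mul_of_nonneg_left (nat_mul_exp_div_sub_one_le (abs_nonneg κ) hn1) (by positivity)
  rw [covGrad, conjMat_finset_sum]
  · rw [← Finset.sum_sub_distrib]
    refine (norm_sum_le _ _).trans ((Finset.sum_le_sum hterm).trans (le_of_eq ?_))
    rw [Finset.sum_const, Finset.card_univ, Fintype.card_fin, nsmul_eq_mul, cR, mul_assoc]

/-- the adjoint: **`‖c(D_Rᴴ) − D_Rᴴ‖ ≤ cR`** (`CTConjugationPieces.opNorm_conjMat_conjTranspose_sub_eq`, `|−κ| = |κ|`). [folklore] -/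
theorem opNorm_conjMat_covGradH_sub_le {R : Fin d → (Tor (fine n M) → Matrix o o ℂ)} {α : ℝ} (hα : 0 ≤ α)
    (hR : ∀ μ x, ‖connS (fine n M) ((n : ℕ) : ℂ) R μ x‖ ≤ α) (hlip : ∀ x ν, |ρ₀ (x + unitVec (fine n M) ν) - ρ₀ x| ≤ 1 / n) (κ : ℝ) :
    ‖conjMat κ (siteW n M ρ₀) (bondCW n M (o := o) ρ₀) (covGrad (fine n M) ((n : ℕ) : ℂ) R)ᴴ - (covGrad (fine n M) ((n : ℕ) : ℂ) R)ᴴ‖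
      ≤ cR d α κ := by
  rw [opNorm_conjMat_conjTranspose_sub_eq]
  have h := opNorm_conjMat_covGrad_sub_le n M (ρ₀ := ρ₀) hα hR hlip (-κ)
  rwa [cR, abs_neg, ← cR] at h

end Gradient

/-! ## §2 Weighted coercivity of the covariant scalar operator -/

section Coercivity

variable {ρ₀ : Tor (fine n M) → ℝ} {κ a' : ℝ}

/-- **conjugation defect of `S_U`**: `ConjDefect (scalarOp n M a′ R T) κ (siteW ρ₀) (Jcov (card o) d a′ α τ κ)` — the substrate's level-free
row defect. [folklore] -/
theorem conjDefect_scalarOp (ha' : 0 ≤ a') {R : Fin d → (Tor (fine n M) → Matrix o o ℂ)} {T : Tor (fine n M) → Matrix o o ℂ}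
    {α τ : ℝ} (hα : 0 ≤ α) (hτ : 0 ≤ τ) (hR : ∀ μ x, ‖connS (fine n M) ((n : ℕ) : ℂ) R μ x‖ ≤ α) (hT : ∀ x, ‖T x - 1‖ ≤ τ)
    (hlip : ∀ x ν, |ρ₀ (x + unitVec (fine n M) ν) - ρ₀ x| ≤ 1 / n) (hosc : ∀ x x', blockOf n M x = blockOf n M x' → |ρ₀ x - ρ₀ x'| ≤ 1) :
    ConjDefect (scalarOp n M a' R T) κ (siteW n M ρ₀) (Jcov (Fintype.card o) d a' α τ κ) :=
  conjDefect_of_rowDefect (scalarOp_isHermitian n M a' R T) fun e => ctRowDefect_scalarOp_le_uniform n M ha' hα hτ hR hT hlip hosc e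

/-- **WEIGHTED COERCIVITY OF `S_U`**: `WCoercive (scalarOp n M a′ R T) κ (siteW ρ₀) (γ_U − Jcov)`. [folklore] -/
theorem wCoercive_scalarOp (ha' : 0 < a') {R : Fin d → (Tor (fine n M) → Matrix o o ℂ)} {T : Tor (fine n M) → Matrix o o ℂ}
    {α τ : ℝ} (hα : 0 ≤ α) (hτ : 0 ≤ τ) (hR : ∀ μ x, ‖connS (fine n M) ((n : ℕ) : ℂ) R μ x‖ ≤ α) (hT : ∀ x, ‖T x - 1‖ ≤ τ)
    (hlip : ∀ x ν, |ρ₀ (x + unitVec (fine n M) ν) - ρ₀ x| ≤ 1 / n) (hosc : ∀ x x', blockOf n M x = blockOf n M x' → |ρ₀ x - ρ₀ x'| ≤ 1) :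
    WCoercive (scalarOp n M a' R T) κ (siteW n M ρ₀) (gammaU d a' α τ - Jcov (Fintype.card o) d a' α τ κ) :=
  wCoercive_of_coercive (coercive_scalarOp n M ha' hα hτ hR hT) (conjDefect_scalarOp n M ha'.le hα hτ hR hT hlip hosc)

end Coercivity

/-! ## §3 The conjugation bounds of `G′_U`, `D_RG′_U`, `G′_UD_Rᴴ`, `D_RG′_UD_Rᴴ` -/

section Bounds

variable {ρ₀ : Tor (fine n M) → ℝ} {κ a' : ℝ}

/-- the Gram-plus-positive shape `S_U = D_RᴴD_R + a′(BT)ᴴ(BT)`. [folklore] -/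
theorem scalarOp_eq_gram (a' : ℝ) (R : Fin d → (Tor (fine n M) → Matrix o o ℂ)) (T : Tor (fine n M) → Matrix o o ℂ) :
    scalarOp n M a' R T = (covGrad (fine n M) ((n : ℕ) : ℂ) R)ᴴ * covGrad (fine n M) ((n : ℕ) : ℂ) R
      + (a' : ℂ) • ((Bs o n M * siteMul T)ᴴ * (Bs o n M * siteMul T)) := by
  rw [scalarOp, covGrad_conjTranspose_mul_covGrad]

/-- the mass term is positive semidefinite (`a′ ≥ 0`). [folklore] -/
theorem massTerm_posSemidef (ha' : 0 ≤ a') (T : Tor (fine n M) → Matrix o o ℂ) :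
    ((a' : ℂ) • ((Bs o n M * siteMul T)ᴴ * (Bs o n M * siteMul T))).PosSemidef := by
  have h := Matrix.posSemidef_conjTranspose_mul_self (Bs o n M * siteMul T)
  have ha'c : (0 : ℂ) ≤ (a' : ℂ) := Complex.zero_le_real.mpr ha'
  exact h.smul ha'c

variable {R : Fin d → (Tor (fine n M) → Matrix o o ℂ)} {T : Tor (fine n M) → Matrix o o ℂ} {α τ : ℝ}

/-- **`‖c(G′_U)‖ ≤ (γ_U − Jcov)⁻¹`**. [folklore] -/
theorem opNorm_conjMat_scalarOp_inv_le (ha' : 0 < a') (hα : 0 ≤ α) (hτ : 0 ≤ τ)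
    (hR : ∀ μ x, ‖connS (fine n M) ((n : ℕ) : ℂ) R μ x‖ ≤ α) (hT : ∀ x, ‖T x - 1‖ ≤ τ)
    (hlip : ∀ x ν, |ρ₀ (x + unitVec (fine n M) ν) - ρ₀ x| ≤ 1 / n) (hosc : ∀ x x', blockOf n M x = blockOf n M x' → |ρ₀ x - ρ₀ x'| ≤ 1)
    (hγ : 0 < gammaU d a' α τ - Jcov (Fintype.card o) d a' α τ κ) :
    ‖conjMat κ (siteW n M ρ₀) (siteW n M ρ₀) (scalarOp n M a' R T)⁻¹‖ ≤ (gammaU d a' α τ - Jcov (Fintype.card o) d a' α τ κ)⁻¹ :=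
  opNorm_conjMat_inv_le' (wCoercive_scalarOp n M ha' hα hτ hR hT hlip hosc) hγ

/-- **`‖c(D_RG′_U)‖ ≤ √(1/γw + J/γw²) + cR/γw`**. [folklore] -/
theorem opNorm_conjMat_covGrad_inv_le (ha' : 0 < a') (hα : 0 ≤ α) (hτ : 0 ≤ τ)
    (hR : ∀ μ x, ‖connS (fine n M) ((n : ℕ) : ℂ) R μ x‖ ≤ α) (hT : ∀ x, ‖T x - 1‖ ≤ τ)
    (hlip : ∀ x ν, |ρ₀ (x + unitVec (fine n M) ν) - ρ₀ x| ≤ 1 / n) (hosc : ∀ x x', blockOf n M x = blockOf n M x' → |ρ₀ x - ρ₀ x'| ≤ 1)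
    (hγ : 0 < gammaU d a' α τ - Jcov (Fintype.card o) d a' α τ κ) :
    ‖conjMat κ (bondCW n M (o := o) ρ₀) (siteW n M ρ₀) (covGrad (fine n M) ((n : ℕ) : ℂ) R * (scalarOp n M a' R T)⁻¹)‖
      ≤ Real.sqrt (1 / (gammaU d a' α τ - Jcov (Fintype.card o) d a' α τ κ)
          + Jcov (Fintype.card o) d a' α τ κ / (gammaU d a' α τ - Jcov (Fintype.card o) d a' α τ κ) ^ 2)
        + cR d α κ / (gammaU d a' α τ - Jcov (Fintype.card o) d a' α τ κ) :=
  opNorm_conjMat_X_inv_le (scalarOp_eq_gram n M a' R T) (massTerm_posSemidef n M ha'.le T)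
    (wCoercive_scalarOp n M ha' hα hτ hR hT hlip hosc) hγ (conjDefect_scalarOp n M ha'.le hα hτ hR hT hlip hosc)
    (Jcov_nonneg _ _ ha'.le hα κ) (opNorm_conjMat_covGrad_sub_le n M hα hR hlip κ)

/-- **`‖c(G′_UD_Rᴴ)‖ ≤ K₂`**. [folklore] -/
theorem opNorm_conjMat_inv_covGradH_le (ha' : 0 < a') (hα : 0 ≤ α) (hτ : 0 ≤ τ)
    (hR : ∀ μ x, ‖connS (fine n M) ((n : ℕ) : ℂ) R μ x‖ ≤ α) (hT : ∀ x, ‖T x - 1‖ ≤ τ)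
    (hlip : ∀ x ν, |ρ₀ (x + unitVec (fine n M) ν) - ρ₀ x| ≤ 1 / n) (hosc : ∀ x x', blockOf n M x = blockOf n M x' → |ρ₀ x - ρ₀ x'| ≤ 1)
    (hγ : 0 < gammaU d a' α τ - Jcov (Fintype.card o) d a' α τ κ) :
    ‖conjMat κ (siteW n M ρ₀) (bondCW n M (o := o) ρ₀) ((scalarOp n M a' R T)⁻¹ * (covGrad (fine n M) ((n : ℕ) : ℂ) R)ᴴ)‖
      ≤ K2 (gammaU d a' α τ - Jcov (Fintype.card o) d a' α τ κ) (Jcov (Fintype.card o) d a' α τ κ) (cR d α κ) :=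
  opNorm_conjMat_inv_XH_le (scalarOp_eq_gram n M a' R T) (massTerm_posSemidef n M ha'.le T)
    (wCoercive_scalarOp n M ha' hα hτ hR hT hlip hosc) hγ (conjDefect_scalarOp n M ha'.le hα hτ hR hT hlip hosc)
    (Jcov_nonneg _ _ ha'.le hα κ) (opNorm_conjMat_covGradH_sub_le n M hα hR hlip κ)

/-- **`‖D_R·c(G′_UD_Rᴴ)‖ ≤ K₁`**. [folklore] -/
theorem opNorm_covGrad_conjMat_inv_covGradH_le (ha' : 0 < a') (hα : 0 ≤ α) (hτ : 0 ≤ τ)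
    (hR : ∀ μ x, ‖connS (fine n M) ((n : ℕ) : ℂ) R μ x‖ ≤ α) (hT : ∀ x, ‖T x - 1‖ ≤ τ)
    (hlip : ∀ x ν, |ρ₀ (x + unitVec (fine n M) ν) - ρ₀ x| ≤ 1 / n) (hosc : ∀ x x', blockOf n M x = blockOf n M x' → |ρ₀ x - ρ₀ x'| ≤ 1)
    (hγ : 0 < gammaU d a' α τ - Jcov (Fintype.card o) d a' α τ κ) :
    ‖covGrad (fine n M) ((n : ℕ) : ℂ) R
        * conjMat κ (siteW n M ρ₀) (bondCW n M (o := o) ρ₀) ((scalarOp n M a' R T)⁻¹ * (covGrad (fine n M) ((n : ℕ) : ℂ) R)ᴴ)‖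
      ≤ K1 (gammaU d a' α τ - Jcov (Fintype.card o) d a' α τ κ) (Jcov (Fintype.card o) d a' α τ κ) (cR d α κ) :=
  opNorm_X_conjMat_inv_XH_le (scalarOp_eq_gram n M a' R T) (massTerm_posSemidef n M ha'.le T)
    (wCoercive_scalarOp n M ha' hα hτ hR hT hlip hosc) hγ (conjDefect_scalarOp n M ha'.le hα hτ hR hT hlip hosc)
    (Jcov_nonneg _ _ ha'.le hα κ) (opNorm_conjMat_covGradH_sub_le n M hα hR hlip κ)

/-- **`‖c(D_RG′_UD_Rᴴ)‖ ≤ K₁ + cR·K₂`** — the conjugated covariant gauge sandwich with the IDENTITY in the middle; the middle factor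
`Q′ᴴNQ′` of the gauge slot is file E2. [folklore] -/
theorem opNorm_conjMat_sand_inv_le (ha' : 0 < a') (hα : 0 ≤ α) (hτ : 0 ≤ τ)
    (hR : ∀ μ x, ‖connS (fine n M) ((n : ℕ) : ℂ) R μ x‖ ≤ α) (hT : ∀ x, ‖T x - 1‖ ≤ τ)
    (hlip : ∀ x ν, |ρ₀ (x + unitVec (fine n M) ν) - ρ₀ x| ≤ 1 / n) (hosc : ∀ x x', blockOf n M x = blockOf n M x' → |ρ₀ x - ρ₀ x'| ≤ 1)
    (hγ : 0 < gammaU d a' α τ - Jcov (Fintype.card o) d a' α τ κ) :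
    ‖conjMat κ (bondCW n M (o := o) ρ₀) (bondCW n M (o := o) ρ₀)
        (sand (fine n M) ((n : ℕ) : ℂ) R (scalarOp n M a' R T)⁻¹)‖
      ≤ K1 (gammaU d a' α τ - Jcov (Fintype.card o) d a' α τ κ) (Jcov (Fintype.card o) d a' α τ κ) (cR d α κ)
        + cR d α κ * K2 (gammaU d a' α τ - Jcov (Fintype.card o) d a' α τ κ) (Jcov (Fintype.card o) d a' α τ κ) (cR d α κ) := by
  rw [sand, Matrix.mul_assoc]
  exact opNorm_conjMat_X_inv_XH_le (scalarOp_eq_gram n M a' R T) (massTerm_posSemidef n M ha'.le T)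
    (wCoercive_scalarOp n M ha' hα hτ hR hT hlip hosc) hγ (conjDefect_scalarOp n M ha'.le hα hτ hR hT hlip hosc)
    (Jcov_nonneg _ _ ha'.le hα κ) (opNorm_conjMat_covGrad_sub_le n M hα hR hlip κ) (opNorm_conjMat_covGradH_sub_le n M hα hR hlip κ)

end Bounds

end Summit.QuantumFields.BalabanUV.T4Continuum.CTCovariantScalarGreen

end
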